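import Literature.AlgebraicGeometry.GroupSchemes.CartierDualAnnihilator
import HarnessLib

/-!
# Functoriality of the annihilator: `β(H₁) ⊆ H₂ ⟹ β^D(H₂^⊥) ⊆ H₁^⊥` — stability and antitonicity of `H^⊥` (Tate 1997 §(3.8))

Layer `Literature/AlgebraicGeometry/GroupSchemes`, namespace `Literature.AlgebraicGeometry.GroupSchemes.AffineGroupScheme` (continues ★
`CartierDualAnnihilator` p845459 — `annihilator j = H^⊥ := ker (j^D)`, `annihilatorι`, `annihilator_hom_ext` — and ★ `CartierDualMap` p845343 —
`cartierDualMap β = β^D`, `cartierDualMap_comp`, `cartierDualMap_id`).  ONE plumbing definition with body (`annihilatorMap`, a `kerLift`) + theorems;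
no instance, no notation, no named fact, no `sorry`.  Cell `hodgecm-mathlib` (D-0151), programme P6 «MOD», HEART organ ST-0′ row **(g3-a)** «annihilator
bookkeeping» (LEAD F0P6-plan (g0) M-16 (6); A-p17 (g24) 15:43:40Z sharpen (i)(ii): «an endomorphism `β` of `G` with `j`-stable `H` gives `β^D` with
stable `H^⊥` = the `𝒪_F`-stability clause of ST-0 for free» and «antitonicity `H ≤ H′ ⇒ H′^⊥ ≤ H^⊥` in factorisation form»; A-p06 (g30)).
Count-neutral Mathlib-side capital: HC_CM is proved only modulo the 7 printed citations until rung 0 closes; nothing here bears on it.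

THE PRINT ([Tate1997FiniteFlatGroupSchemes] §(3.8) pp. 145–146: `G ↦ G^D` is an exact contravariant functor; for `H ⊂ G` the characters of `G`
trivial on `H` form `(G⧸H)^D ⊂ G^D`).  GENERALISE: for homomorphisms `β : G₁ → G₂`, `j₁ : H₁ → G₁`, `j₂ : H₂ → G₂` of finite free commutative
group schemes over `R` and a homomorphism `t : H₁ → H₂` with `t ≫ j₂ = j₁ ≫ β` («`β` maps `H₁` into `H₂`»), the dual `β^D : G₂^D → G₁^D` maps
`H₂^⊥` into `H₁^⊥`: indeed `β^D ≫ j₁^D = (j₁ ≫ β)^D = (t ≫ j₂)^D = j₂^D ≫ t^D` (★ `cartierDualMap_comp`), so on `H₂^⊥ = ker j₂^D` the composite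
`ι₂ ≫ β^D ≫ j₁^D = (ι₂ ≫ j₂^D) ≫ t^D = 1 ≫ t^D = 1` and `ι₂ ≫ β^D` lifts through `H₁^⊥ = ker j₁^D` (★ `kerLift`).  SPECIALISE: (stability)
`G₁ = G₂ = G`, `H₁ = H₂ = H` — an endomorphism `β` of `G` stabilising `H` has `β^D` stabilising `H^⊥` (for the HEART: `C ⊂ 𝒜_t[ϖ]` stable under
`ι(a)`, `a ∈ 𝒪_F`, gives `C^⊥` stable under `ι(a)^D`); (antitonicity) `β = 𝟙_G` — `H₁ ≤ H₂` inside `G` gives `H₂^⊥ ≤ H₁^⊥` inside `G^D`, by a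
homomorphism which is a closed immersion.

* §1 **`annihilatorMap j₁ j₂ β t h : annihilator j₂ ⟶ annihilator j₁`** (`h : t ≫ j₂ = j₁ ≫ β`), `annihilatorMap_comp_ι` (`… ≫ ι₁ = ι₂ ≫ β^D`),
  uniqueness `eq_annihilatorMap`, `isMonHom_annihilatorMap`, and the factorisation form `exists_comp_annihilatorι_eq_annihilatorι_comp_cartierDualMap`;
  functoriality `annihilatorMap_id`, `annihilatorMap_comp`.
* §2 (stability) **`exists_comp_annihilatorι_eq_of_stable`** — `t ≫ j = j ≫ β ⟹ ∃ t′, t′ ≫ ι = ι ≫ β^D` (with `t′` a homomorphism).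
* §3 (antitonicity) **`annihilatorMapOfLE`** `:= annihilatorMap j₁ j₂ (𝟙 G) t _ : annihilator j₂ ⟶ annihilator j₁` with `annihilatorMapOfLE_comp_ι`
  (`… ≫ ι₁ = ι₂` — `H₂^⊥ ≤ H₁^⊥` over `G^D`), `mono_annihilatorMapOfLE`, **`isClosedImmersion_annihilatorMapOfLE_left`**.

NOT here: the rank clause `rk H^⊥ · rk H = rk G` and the double annihilator `(H^⊥)^⊥ = H` (wait for «a finite commutative Hopf algebra over a field is
free over a Hopf subalgebra»), base change of `H^⊥` (rider (b) of ★ `CartierDualAnnihilator`'s author).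

## References
* [Tate1997FiniteFlatGroupSchemes] J. Tate, *Finite flat group schemes*, in: Modular Forms and Fermat's Last Theorem (1997), §(3.8) pp. 144–146.
* [GortzWedhorn2020] U. Görtz, T. Wedhorn, *Algebraic Geometry I: Schemes*, 2nd ed. (2020), (4.15) Definition 4.45, p. 117 (kernels; closed subgroup schemes).
-/

set_option autoImplicit false

-- Mathlib's `Over`/`Scheme` APIs are stated across semireducible wrappers (as in the ★ `GroupSchemes/*` files).
set_option backward.isDefEq.respectTransparency false

universe u

open CategoryTheory CategoryTheory.Limits AlgebraicGeometry MonoidalCategory CartesianMonoidalCategory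

noncomputable section

namespace Literature.AlgebraicGeometry.GroupSchemes

namespace AffineGroupScheme

open scoped MonObj

open Literature.AlgebraicGeometry.Motives Literature.NumberTheory.DiophantineGeometry GroupSchemeKernel

variable {R : Type u} [CommRing R] {H₁ G₁ H₂ G₂ H₃ G₃ : SchemeOver R}
  [GrpObj H₁] [IsCommMonObj H₁] [IsAffine H₁.left] [Module.Free R (Alg H₁)] [Module.Finite R (Alg H₁)]
  [GrpObj G₁] [IsCommMonObj G₁] [IsAffine G₁.left]
  [GrpObj H₂] [IsCommMonObj H₂] [IsAffine H₂.left] [Module.Free R (Alg H₂)] [Module.Finite R (Alg H₂)]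
  [GrpObj G₂] [IsCommMonObj G₂] [IsAffine G₂.left]
  [GrpObj H₃] [IsCommMonObj H₃] [IsAffine H₃.left] [Module.Free R (Alg H₃)] [Module.Finite R (Alg H₃)]
  [GrpObj G₃] [IsCommMonObj G₃] [IsAffine G₃.left]
  (j₁ : H₁ ⟶ G₁) [IsMonHom j₁] (j₂ : H₂ ⟶ G₂) [IsMonHom j₂] (j₃ : H₃ ⟶ G₃) [IsMonHom j₃]

/-! ## §1 `β(H₁) ⊆ H₂ ⟹ β^D(H₂^⊥) ⊆ H₁^⊥` -/

section Map

variable (β : G₁ ⟶ G₂) [IsMonHom β] (t : H₁ ⟶ H₂) [IsMonHom t] (h : t ≫ j₂ = j₁ ≫ β)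

omit [IsMonHom j₁] [IsMonHom j₂] [Module.Free R (Alg H₁)] [Module.Finite R (Alg H₁)] in
/-- `cartierDualMap` depends only on the homomorphism, not on the `IsMonHom` witness. [cite: Tate1997FiniteFlatGroupSchemes, §(3.8) p. 145] -/
theorem cartierDualMap_congr {f g : H₁ ⟶ G₂} [IsMonHom f] [IsMonHom g] (hfg : f = g) : cartierDualMap f = cartierDualMap g := by
  subst hfg
  rfl

omit [Module.Free R (Alg H₁)] [Module.Finite R (Alg H₁)] [Module.Free R (Alg H₂)] [Module.Finite R (Alg H₂)] in
include h in
/-- **`β^D ≫ j₁^D = j₂^D ≫ t^D`** when `t ≫ j₂ = j₁ ≫ β` (both are `(j₁ ≫ β)^D = (t ≫ j₂)^D`, ★ `cartierDualMap_comp`).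
[cite: Tate1997FiniteFlatGroupSchemes, §(3.8) p. 145] -/
theorem cartierDualMap_comp_cartierDualMap_eq_of_comp_eq :
    cartierDualMap β ≫ cartierDualMap j₁ = cartierDualMap j₂ ≫ cartierDualMap t := by
  rw [← cartierDualMap_comp, cartierDualMap_congr h.symm, cartierDualMap_comp]

include h in
/-- `H₂^⊥ → G₂^D → G₁^D → H₁^D` is trivial: `ι₂ ≫ β^D ≫ j₁^D = (ι₂ ≫ j₂^D) ≫ t^D = 1 ≫ t^D = 1`.
[cite: Tate1997FiniteFlatGroupSchemes, §(3.8) p. 146] -/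
theorem annihilatorι_comp_cartierDualMap_comp_cartierDualMap :
    (annihilatorι j₂ ≫ cartierDualMap β) ≫ cartierDualMap j₁ = 1 := by
  rw [Category.assoc, cartierDualMap_comp_cartierDualMap_eq_of_comp_eq j₁ j₂ β t h, ← Category.assoc, annihilatorι_comp,
    MonObj.one_comp]

/-- **`β^D` restricted to the annihilators, `H₂^⊥ → H₁^⊥`**, for `β : G₁ → G₂` mapping `H₁` into `H₂` (`t ≫ j₂ = j₁ ≫ β`): the lift of
`ι₂ ≫ β^D` through `H₁^⊥ = ker j₁^D` (★ `kerLift`). [cite: Tate1997FiniteFlatGroupSchemes, §(3.8) p. 146] -/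
def annihilatorMap : annihilator j₂ ⟶ annihilator j₁ :=
  kerLift (annihilatorι j₂ ≫ cartierDualMap β) (annihilatorι_comp_cartierDualMap_comp_cartierDualMap j₁ j₂ β t h)

/-- **`annihilatorMap ≫ ι₁ = ι₂ ≫ β^D`** — `β^D(H₂^⊥) ⊆ H₁^⊥`. [cite: Tate1997FiniteFlatGroupSchemes, §(3.8) p. 146] -/
@[reassoc]
theorem annihilatorMap_comp_ι : annihilatorMap j₁ j₂ β t h ≫ annihilatorι j₁ = annihilatorι j₂ ≫ cartierDualMap β :=
  kerLift_ι _ _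

/-- Uniqueness: a morphism `H₂^⊥ → H₁^⊥` over `ι₂ ≫ β^D` IS `annihilatorMap` (★ `annihilator_hom_ext`). [cite: GortzWedhorn2020, Definition 4.45 (2), p. 117] -/
theorem eq_annihilatorMap (u : annihilator j₂ ⟶ annihilator j₁) (hu : u ≫ annihilatorι j₁ = annihilatorι j₂ ≫ cartierDualMap β) :
    u = annihilatorMap j₁ j₂ β t h :=
  annihilator_hom_ext j₁ (by rw [hu, annihilatorMap_comp_ι])

/-- `annihilatorMap` is a homomorphism of group schemes (★ `isMonHom_kerLift`: `ι₂ ≫ β^D` is one). [cite: GortzWedhorn2020, Definition 4.45 (2), p. 117] -/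
theorem isMonHom_annihilatorMap [Module.Free R (Alg G₁)] [Module.Finite R (Alg G₁)] [Module.Free R (Alg G₂)] [Module.Finite R (Alg G₂)] :
    IsMonHom (annihilatorMap j₁ j₂ β t h) :=
  isMonHom_kerLift (f := cartierDualMap j₁) (annihilatorι j₂ ≫ cartierDualMap β) _

include h in
/-- **Factorisation form: `β(H₁) ⊆ H₂ ⟹ β^D(H₂^⊥) ⊆ H₁^⊥`** — there is a homomorphism `t′ : H₂^⊥ → H₁^⊥` with `t′ ≫ ι₁ = ι₂ ≫ β^D`.
[cite: Tate1997FiniteFlatGroupSchemes, §(3.8) p. 146] -/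
theorem exists_comp_annihilatorι_eq_annihilatorι_comp_cartierDualMap
    [Module.Free R (Alg G₁)] [Module.Finite R (Alg G₁)] [Module.Free R (Alg G₂)] [Module.Finite R (Alg G₂)] :
    ∃ t' : annihilator j₂ ⟶ annihilator j₁, IsMonHom t' ∧ t' ≫ annihilatorι j₁ = annihilatorι j₂ ≫ cartierDualMap β :=
  ⟨annihilatorMap j₁ j₂ β t h, isMonHom_annihilatorMap j₁ j₂ β t h, annihilatorMap_comp_ι j₁ j₂ β t h⟩

end Map

/-- Functoriality, identities: `annihilatorMap` of `(𝟙_G, 𝟙_H)` is `𝟙_{H^⊥}` (★ `cartierDualMap_id`). [cite: Tate1997FiniteFlatGroupSchemes, §(3.8) p. 145] -/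
theorem annihilatorMap_id :
    annihilatorMap j₁ j₁ (𝟙 G₁) (𝟙 H₁) (by rw [Category.id_comp, Category.comp_id]) = 𝟙 (annihilator j₁) :=
  (eq_annihilatorMap j₁ j₁ (𝟙 G₁) (𝟙 H₁) _ (𝟙 _) (by rw [cartierDualMap_id, Category.id_comp, Category.comp_id])).symm

/-- Functoriality, composition: for `β : G₁ → G₂`, `β' : G₂ → G₃` mapping `H₁` into `H₂` and `H₂` into `H₃`, the map of annihilators of
`β ≫ β'` is `annihilatorMap β' ≫ annihilatorMap β` (`(β ≫ β')^D = β'^D ≫ β^D`, ★ `cartierDualMap_comp`). [cite: Tate1997FiniteFlatGroupSchemes, §(3.8) p. 145] -/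
theorem annihilatorMap_comp (β : G₁ ⟶ G₂) [IsMonHom β] (β' : G₂ ⟶ G₃) [IsMonHom β'] (t : H₁ ⟶ H₂) [IsMonHom t] (s : H₂ ⟶ H₃) [IsMonHom s]
    (hβ : t ≫ j₂ = j₁ ≫ β) (hβ' : s ≫ j₃ = j₂ ≫ β') :
    annihilatorMap j₁ j₃ (β ≫ β') (t ≫ s) (by rw [Category.assoc, hβ', reassoc_of% hβ]) =
      annihilatorMap j₂ j₃ β' s hβ' ≫ annihilatorMap j₁ j₂ β t hβ :=
  (eq_annihilatorMap j₁ j₃ (β ≫ β') (t ≫ s) _ _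
    (by rw [Category.assoc, annihilatorMap_comp_ι, annihilatorMap_comp_ι_assoc, cartierDualMap_comp])).symm

/-! ## §2 Stability: an endomorphism of `G` stabilising `H` has dual stabilising `H^⊥` -/

/-- **STABILITY OF THE ANNIHILATOR.** If an endomorphism `β` of `G` stabilises the subgroup `j : H → G` — `t ≫ j = j ≫ β` for an endomorphism
`t` of `H` — then `β^D` stabilises `H^⊥ ⊂ G^D`: there is an endomorphism `t′` of `H^⊥` (a homomorphism) with `t′ ≫ ι = ι ≫ β^D`.  (HEART use: an
`𝒪_F`-stable `C ⊂ 𝒜_t[ϖ]` has an `𝒪_F`-stable annihilator, `a ↦ ι(a)^D`.) [cite: Tate1997FiniteFlatGroupSchemes, §(3.8) p. 146] -/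
theorem exists_comp_annihilatorι_eq_of_stable [Module.Free R (Alg G₁)] [Module.Finite R (Alg G₁)] (β : G₁ ⟶ G₁) [IsMonHom β]
    (t : H₁ ⟶ H₁) [IsMonHom t] (h : t ≫ j₁ = j₁ ≫ β) :
    ∃ t' : annihilator j₁ ⟶ annihilator j₁, IsMonHom t' ∧ t' ≫ annihilatorι j₁ = annihilatorι j₁ ≫ cartierDualMap β :=
  exists_comp_annihilatorι_eq_annihilatorι_comp_cartierDualMap j₁ j₁ β t h

/-! ## §3 Antitonicity: `H₁ ≤ H₂ ⟹ H₂^⊥ ≤ H₁^⊥` -/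

section Antitone

variable {H₁ H₂ G : SchemeOver R}
  [GrpObj H₁] [IsCommMonObj H₁] [IsAffine H₁.left] [Module.Free R (Alg H₁)] [Module.Finite R (Alg H₁)]
  [GrpObj H₂] [IsCommMonObj H₂] [IsAffine H₂.left] [Module.Free R (Alg H₂)] [Module.Finite R (Alg H₂)]
  [GrpObj G] [IsCommMonObj G] [IsAffine G.left]
  (i₁ : H₁ ⟶ G) [IsMonHom i₁] (i₂ : H₂ ⟶ G) [IsMonHom i₂] (t : H₁ ⟶ H₂) [IsMonHom t] (h : t ≫ i₂ = i₁)

/-- **ANTITONICITY OF THE ANNIHILATOR, the map `H₂^⊥ → H₁^⊥`** for `H₁ ≤ H₂` inside `G` (`t ≫ i₂ = i₁`): `annihilatorMap` at `β = 𝟙_G`.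
[cite: Tate1997FiniteFlatGroupSchemes, §(3.8) p. 146] -/
def annihilatorMapOfLE : annihilator i₂ ⟶ annihilator i₁ :=
  annihilatorMap i₁ i₂ (𝟙 G) t (by rw [h, Category.comp_id])

/-- **`H₂^⊥ ≤ H₁^⊥` over `G^D`**: `annihilatorMapOfLE ≫ ι₁ = ι₂`. [cite: Tate1997FiniteFlatGroupSchemes, §(3.8) p. 146] -/
@[reassoc]
theorem annihilatorMapOfLE_comp_ι : annihilatorMapOfLE i₁ i₂ t h ≫ annihilatorι i₁ = annihilatorι i₂ := by
  rw [annihilatorMapOfLE, annihilatorMap_comp_ι, cartierDualMap_id, Category.comp_id]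

/-- `annihilatorMapOfLE` is a homomorphism. [cite: GortzWedhorn2020, Definition 4.45 (2), p. 117] -/
theorem isMonHom_annihilatorMapOfLE [Module.Free R (Alg G)] [Module.Finite R (Alg G)] : IsMonHom (annihilatorMapOfLE i₁ i₂ t h) :=
  isMonHom_annihilatorMap i₁ i₂ (𝟙 G) t _

/-- `annihilatorMapOfLE` is a monomorphism (it is one after `ι₁`, and `ι₂` is mono). [cite: GortzWedhorn2020, Definition 4.45 (2), p. 117] -/
theorem mono_annihilatorMapOfLE : Mono (annihilatorMapOfLE i₁ i₂ t h) := by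
  haveI := mono_annihilatorι i₂
  exact mono_of_mono_fac (annihilatorMapOfLE_comp_ι i₁ i₂ t h)

/-- **`H₂^⊥ → H₁^⊥` is a CLOSED IMMERSION** (its composite with the closed immersion `ι₁` is the closed immersion `ι₂`; Mathlib
`IsClosedImmersion.of_comp`). [cite: GortzWedhorn2020, Definition 4.45 (2), p. 117] -/
theorem isClosedImmersion_annihilatorMapOfLE_left : IsClosedImmersion (annihilatorMapOfLE i₁ i₂ t h).left := by
  haveI := isClosedImmersion_annihilatorι_left i₁
  haveI : IsClosedImmersion ((annihilatorMapOfLE i₁ i₂ t h).left ≫ (annihilatorι i₁).left) := by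
    rw [← Over.comp_left, annihilatorMapOfLE_comp_ι]
    exact isClosedImmersion_annihilatorι_left i₂
  exact IsClosedImmersion.of_comp (annihilatorMapOfLE i₁ i₂ t h).left (annihilatorι i₁).left

include t h in
/-- Factorisation form of antitonicity: `H₁ ≤ H₂ ⟹ ∃ u, u ≫ ι₁ = ι₂` with `u : H₂^⊥ → H₁^⊥` a homomorphism and a closed immersion.
[cite: Tate1997FiniteFlatGroupSchemes, §(3.8) p. 146] -/
theorem exists_comp_annihilatorι_eq_annihilatorι_of_le [Module.Free R (Alg G)] [Module.Finite R (Alg G)] :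
    ∃ u : annihilator i₂ ⟶ annihilator i₁, IsMonHom u ∧ IsClosedImmersion u.left ∧ u ≫ annihilatorι i₁ = annihilatorι i₂ :=
  ⟨annihilatorMapOfLE i₁ i₂ t h, isMonHom_annihilatorMapOfLE i₁ i₂ t h, isClosedImmersion_annihilatorMapOfLE_left i₁ i₂ t h,
    annihilatorMapOfLE_comp_ι i₁ i₂ t h⟩

end Antitone

end AffineGroupScheme

end Literature.AlgebraicGeometry.GroupSchemes

end
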